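import Summits.AtomisticToContinuum.FouriersLaw.Theorems.VanishingNoiseTransferVanishingNoiseBoundJumpPerturbationSemigroup

/-!
# Jump perturbation of a measurable Markov semigroup, VI: invariant measures pass to the perturbation
(`--supports stmt-AtomisticToContinuum-11977` helper file, crux `VanishingNoiseTransfer.NoisyFourier`, line
`abel-storage-decay`, registered stub `stub_timeProfileMatching`, half T1 = the fixed-`L` time-profile
representation of the Abel pairing; worker T1 of lead c6, part 1 of 4)

The time-profile representation `σ_L(s) = ∫₀^∞ e^{-st} ⟨J_L, V_t J_L⟩_{μ_T} dt` of the Abel–Green–Kubo pairing of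
the velocity-flip pinned chain rests on the INVARIANCE of the Gibbs measure `μ_T` under the flip semigroup
`V_t = e^{t(L + εS)}`, which the tree realises (`VanishingNoiseBound.exists_flipSemigroup`) as the Dyson–Phillips
jump perturbation `V_t = ∑_n U_n(t)` of the flip-free semigroup `P_t` by the uniform flip kernel `Q` at rate
`r = Nε` (files `…JumpPerturbation{Core,Mass,CK,Semigroup,Resolvent}`). This file is the model-independent step:
for an abstract measurable space `X`, a Markov kernel `K` from `ℝ × X` (the time-extended kernel `P_{t⁺}`), a Markov
jump kernel `Q`, a rate `r > 0` and the Dyson–Phillips family `U_n` (characterised by `U_0(t) = e^{-rt}P_t` and the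
last-jump recursion), every s-finite measure `μ` invariant under all `P_t` and under `Q` satisfies

* `lintegral_lintegral_U_of_invariant` — `μ U_n(t) = p_n(t) μ`, `p_n(t) = e^{-rt}(rt)^n/n!` (induction on `n`
  through the last-jump recursion and Tonelli; `lintegral_expMeasure_indicator_poissonWeight` is the Poisson
  recursion `∫ Exp_r(dσ) 1_{σ<t} p_n(t − σ) = p_{n+1}(t)`);
* `lintegral_lintegral_V_of_invariant`, `bind_V_of_invariant` — hence `μ V_t = μ` (`∑_n p_n(t) = 1`).

Registered sub-goal: `helper_dysonPhillipsInvariant` (the same on the phase space of the chain). No definitions.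
References: Ethier–Kurtz 1986, Ch. 4 §10 (bounded jump perturbations); folklore.
-/

noncomputable section

namespace Summit.AtomisticToContinuum.FouriersLaw.Theorems.VanishingNoiseBound.JumpPerturbation

open MeasureTheory ProbabilityTheory Filter Topology Set Function
open scoped NNReal ENNReal

variable {X : Type*} [MeasurableSpace X]

/-- **The Poisson recursion, integrated form**: `∫ Exp_r(dσ) 1_{σ<t} p_n(t − σ) = p_{n+1}(t)` for the
Poisson weights `p_n(t) = e^{-rt}(rt)^n/n!` (`r, t ≥ 0`). [folklore] -/
theorem lintegral_expMeasure_indicator_poissonWeight {r : ℝ} (hr : 0 ≤ r) (n : ℕ) {t : ℝ} (ht : 0 ≤ t) :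
    ∫⁻ σ, (Iio t).indicator (fun σ => ENNReal.ofReal
        (Real.exp (-(r * (t - σ))) * (r * (t - σ)) ^ n / n.factorial)) σ ∂(expMeasure r) =
      ENNReal.ofReal (Real.exp (-(r * t)) * (r * t) ^ (n + 1) / (n + 1).factorial) := by
  -- adapted from `measure_univ_U` (…JumpPerturbationMass): the same computation without the kernels
  rw [lintegral_expMeasure_indicator r t (by fun_prop)]
  have hpt : ∀ s, ENNReal.ofReal (r * Real.exp (-(r * s))) *
      ENNReal.ofReal (Real.exp (-(r * (t - s))) * (r * (t - s)) ^ n / n.factorial) =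
      ENNReal.ofReal (Real.exp (-(r * t)) * r ^ (n + 1) / n.factorial * (t - s) ^ n) := by
    intro s
    rw [mul_pow, ← ENNReal.ofReal_mul (by positivity)]
    congr 1
    have hexp : Real.exp (-(r * s)) * Real.exp (-(r * (t - s))) = Real.exp (-(r * t)) := by
      rw [← Real.exp_add]; ring_nf
    rw [← hexp]
    set w := (t - s) ^ n
    set e₁ := Real.exp (-(r * s))
    set e₂ := Real.exp (-(r * (t - s)))
    ring
  simp_rw [hpt]
  rw [setLIntegral_mul_sub_pow ht (by positivity) n]
  congr 1
  rw [Nat.factorial_succ]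
  push_cast
  field_simp
  ring

section Family

variable (K : Kernel (ℝ × X) X) (Q : Kernel X X) {r : ℝ}
  (hr : 0 < r) (U : ℕ → Kernel (ℝ × X) X)
  (hU0 : ∀ p : ℝ × X, 0 ≤ p.1 → U 0 p = ENNReal.ofReal (Real.exp (-(r * p.1))) • K p)
  (hUsucc : ∀ (n : ℕ) (p : ℝ × X) (f : X → ℝ≥0∞), Measurable f →
    ∫⁻ z, f z ∂(U (n + 1) p) =
      ∫⁻ s, (Iio p.1).indicator (fun s =>
        ∫⁻ y, ∫⁻ y', ∫⁻ z, f z ∂(K (s, y')) ∂(Q y) ∂(U n (p.1 - s, p.2))) s ∂(expMeasure r))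

include hr hU0 hUsucc in
/-- **Invariant measures and the jump expansion.** If an s-finite measure `μ` is invariant under every
`P_t = K(t, ·)` and under the jump kernel `Q`, then `μ U_n(t) = p_n(t) μ` with the Poisson weight
`p_n(t) = e^{-rt}(rt)^n/n!` (`t ≥ 0`): in integrated form `∫ μ(dx) ∫ f dU_n(t, x) = p_n(t) ∫ f dμ` for measurable
`f ≥ 0`. Induction on `n` through the last-jump recursion: Tonelli in (state, time since the last jump), the
induction hypothesis at time `t − σ`, invariance under `Q` and `P_σ`, and the Poisson recursion.
[Ethier–Kurtz 1986, Ch. 4 §10; folklore] -/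
theorem lintegral_lintegral_U_of_invariant [IsSFiniteKernel Q] [∀ n, IsFiniteKernel (U n)]
    {μ : Measure X} [SFinite μ]
    (hK : ∀ (t : ℝ) (f : X → ℝ≥0∞), Measurable f → ∫⁻ x, ∫⁻ z, f z ∂(K (t, x)) ∂μ = ∫⁻ z, f z ∂μ)
    (hQ : ∀ f : X → ℝ≥0∞, Measurable f → ∫⁻ x, ∫⁻ z, f z ∂(Q x) ∂μ = ∫⁻ z, f z ∂μ)
    (n : ℕ) {t : ℝ} (ht : 0 ≤ t) {f : X → ℝ≥0∞} (hf : Measurable f) :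
    ∫⁻ x, ∫⁻ z, f z ∂(U n (t, x)) ∂μ =
      ENNReal.ofReal (Real.exp (-(r * t)) * (r * t) ^ n / n.factorial) * ∫⁻ z, f z ∂μ := by
  haveI := isProbabilityMeasure_expMeasure hr
  induction n generalizing t f with
  | zero =>
    have h1 : ∀ x, ∫⁻ z, f z ∂(U 0 (t, x)) =
        ENNReal.ofReal (Real.exp (-(r * t))) * ∫⁻ z, f z ∂(K (t, x)) :=
      fun x => lintegral_U_zero K U hU0 ht x f
    simp_rw [h1]
    rw [lintegral_const_mul _ (measurable_lintegral_slice K t hf), hK t f hf]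
    simp
  | succ n ih =>
    -- the one-jump observable
    set F : ℝ × X → ℝ≥0∞ := fun q => ∫⁻ y', ∫⁻ z, f z ∂(K (q.1, y')) ∂(Q q.2) with hF
    have hFm : Measurable F := measurable_jumpObs K Q hf
    have h1 : ∀ x, ∫⁻ z, f z ∂(U (n + 1) (t, x)) =
        ∫⁻ σ, (Iio t).indicator (fun σ => ∫⁻ y, F (σ, y) ∂(U n (t - σ, x))) σ ∂(expMeasure r) :=
      fun x => hUsucc n (t, x) f hf
    simp_rw [h1]
    -- Tonelli: swap the initial state and the time since the last jump
    have hG : Measurable fun q : X × ℝ =>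
        (Iio t).indicator (fun σ => ∫⁻ y, F (σ, y) ∂(U n (t - σ, q.1))) q.2 := by
      have h2 := measurable_lintegral_shift (U n) t hFm
      have h3 : Measurable fun q : ℝ × X =>
          (Iio t).indicator (fun σ => ∫⁻ y, F (σ, y) ∂(U n (t - σ, q.2))) q.1 := by
        have : (fun q : ℝ × X => (Iio t).indicator
            (fun σ => ∫⁻ y, F (σ, y) ∂(U n (t - σ, q.2))) q.1) =
            (Iio t ×ˢ (univ : Set X)).indicator
              (fun q : ℝ × X => ∫⁻ w, F (q.1, w) ∂(U n (t - q.1, q.2))) := by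
          funext q
          simp only [indicator, mem_prod, mem_univ, and_true, mem_Iio]
        rw [this]
        exact h2.indicator (measurableSet_Iio.prod MeasurableSet.univ)
      exact h3.comp measurable_swap
    rw [lintegral_lintegral_swap hG.aemeasurable]
    -- at a frozen time since the last jump: induction hypothesis and invariance under `Q`, `P_σ`
    have h4 : ∀ σ, ∫⁻ x, (Iio t).indicator (fun σ => ∫⁻ y, F (σ, y) ∂(U n (t - σ, x))) σ ∂μ =
        (Iio t).indicator (fun σ => ENNReal.ofReal
          (Real.exp (-(r * (t - σ))) * (r * (t - σ)) ^ n / n.factorial)) σ * ∫⁻ z, f z ∂μ := by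
      intro σ
      by_cases hσ : σ < t
      · simp only [indicator_of_mem (mem_Iio.2 hσ)]
        have hFσ : Measurable fun y => F (σ, y) := hFm.comp (measurable_const.prodMk measurable_id)
        rw [ih (t := t - σ) (f := fun y => F (σ, y)) (by linarith) hFσ]
        congr 1
        simp only [hF]
        rw [hQ _ (measurable_lintegral_slice K σ hf), hK σ f hf]
      · simp only [indicator_of_notMem (fun h => hσ (mem_Iio.1 h)), lintegral_const, zero_mul]
    simp_rw [h4]
    have hpm : Measurable fun σ => (Iio t).indicator (fun σ => ENNReal.ofReal
        (Real.exp (-(r * (t - σ))) * (r * (t - σ)) ^ n / n.factorial)) σ :=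
      (by fun_prop : Measurable fun σ : ℝ => ENNReal.ofReal
        (Real.exp (-(r * (t - σ))) * (r * (t - σ)) ^ n / n.factorial)).indicator measurableSet_Iio
    rw [lintegral_mul_const _ hpm, lintegral_expMeasure_indicator_poissonWeight hr.le n ht]

variable (V : ℝ≥0 → Kernel X X) (hV : ∀ (t : ℝ≥0) (x : X), V t x = Measure.sum fun n => U n ((t : ℝ), x))

include hr hU0 hUsucc hV in
/-- **Invariant measures pass to the perturbed semigroup**, integrated form: if `μ` (s-finite) is invariant
under every `P_t` and under `Q`, then `∫ μ(dx) ∫ f dV_t(x, ·) = ∫ f dμ` for the perturbed kernels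
`V_t = ∑_n U_n(t)` and measurable `f ≥ 0` (`∑_n p_n(t) = 1`). [Ethier–Kurtz 1986, Ch. 4 §10; folklore] -/
theorem lintegral_lintegral_V_of_invariant [IsSFiniteKernel Q] [∀ n, IsFiniteKernel (U n)]
    {μ : Measure X} [SFinite μ]
    (hK : ∀ (t : ℝ) (f : X → ℝ≥0∞), Measurable f → ∫⁻ x, ∫⁻ z, f z ∂(K (t, x)) ∂μ = ∫⁻ z, f z ∂μ)
    (hQ : ∀ f : X → ℝ≥0∞, Measurable f → ∫⁻ x, ∫⁻ z, f z ∂(Q x) ∂μ = ∫⁻ z, f z ∂μ)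
    (t : ℝ≥0) {f : X → ℝ≥0∞} (hf : Measurable f) :
    ∫⁻ x, ∫⁻ z, f z ∂(V t x) ∂μ = ∫⁻ z, f z ∂μ := by
  simp_rw [lintegral_V U V hV t _ f]
  rw [lintegral_tsum fun n => (measurable_lintegral_slice (U n) (t : ℝ) hf).aemeasurable]
  simp_rw [lintegral_lintegral_U_of_invariant K Q hr U hU0 hUsucc hK hQ _ t.coe_nonneg hf]
  rw [ENNReal.tsum_mul_right]
  have h := hasSum_one_poissonMeasure ((r : ℝ) * t).toNNReal
  rw [Real.coe_toNNReal _ (mul_nonneg hr.le t.coe_nonneg)] at h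
  rw [← ENNReal.ofReal_tsum_of_nonneg (fun n => by positivity) h.summable, h.tsum_eq,
    ENNReal.ofReal_one, one_mul]

include hr hU0 hUsucc hV in
/-- **Invariant measures pass to the perturbed semigroup**: if `μ` (s-finite) is invariant under every
`P_t` and under `Q`, then `μ V_t = μ` (`μ.bind (V t) = μ`) for every `t ≥ 0`.
[Ethier–Kurtz 1986, Ch. 4 §10; folklore] -/
theorem bind_V_of_invariant [IsSFiniteKernel Q] [∀ n, IsFiniteKernel (U n)]
    {μ : Measure X} [SFinite μ]
    (hK : ∀ (t : ℝ) (f : X → ℝ≥0∞), Measurable f → ∫⁻ x, ∫⁻ z, f z ∂(K (t, x)) ∂μ = ∫⁻ z, f z ∂μ)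
    (hQ : ∀ f : X → ℝ≥0∞, Measurable f → ∫⁻ x, ∫⁻ z, f z ∂(Q x) ∂μ = ∫⁻ z, f z ∂μ)
    (t : ℝ≥0) : μ.bind (V t) = μ := by
  refine Measure.ext fun A hA => ?_
  rw [Measure.bind_apply hA (Kernel.aemeasurable _)]
  have h := lintegral_lintegral_V_of_invariant K Q hr U hU0 hUsucc V hV hK hQ t
    (f := A.indicator 1) (measurable_one.indicator hA)
  simpa only [lintegral_indicator_one hA] using h

end Family

/-- **Registered sub-goal `helper_dysonPhillipsInvariant`** of stmt-AtomisticToContinuum-11977 (brick for the T1 half of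
stub `stub_timeProfileMatching`, line `abel-storage-decay`): `bind_V_of_invariant` on the phase space of the
`N`-particle chain — a measure invariant under the flip-free kernels and under the flip kernel is invariant under
the Dyson–Phillips perturbation — fully quantified and notation-free. [folklore] -/
theorem helper_dysonPhillipsInvariant : ∀ (N : ℕ) (K : ProbabilityTheory.Kernel (ℝ × Literature.MathematicalPhysics.KineticTheory.HeatConduction.PhaseSpace N) (Literature.MathematicalPhysics.KineticTheory.HeatConduction.PhaseSpace N)) (Q : ProbabilityTheory.Kernel (Literature.MathematicalPhysics.KineticTheory.HeatConduction.PhaseSpace N) (Literature.MathematicalPhysics.KineticTheory.HeatConduction.PhaseSpace N)) [ProbabilityTheory.IsSFiniteKernel Q] (r : ℝ), 0 < r → ∀ (U : ℕ → ProbabilityTheory.Kernel (ℝ × Literature.MathematicalPhysics.KineticTheory.HeatConduction.PhaseSpace N) (Literature.MathematicalPhysics.KineticTheory.HeatConduction.PhaseSpace N)) [∀ n, ProbabilityTheory.IsFiniteKernel (U n)], (∀ p : ℝ × Literature.MathematicalPhysics.KineticTheory.HeatConduction.PhaseSpace N, 0 ≤ p.1 → U 0 p = ENNReal.ofReal (Real.exp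 (-(r * p.1))) • K p) → (∀ (n : ℕ) (p : ℝ × Literature.MathematicalPhysics.KineticTheory.HeatConduction.PhaseSpace N) (f : Literature.MathematicalPhysics.KineticTheory.HeatConduction.PhaseSpace N → ENNReal), Measurable f → MeasureTheory.lintegral (U (n + 1) p) (fun z => f z) = MeasureTheory.lintegral (ProbabilityTheory.expMeasure r) (fun s => (Set.Iio p.1).indicator (fun s => MeasureTheory.lintegral (U n (p.1 - s, p.2)) (fun y => MeasureTheory.lintegral (Q y) (fun y' => MeasureTheory.lintegral (K (s, y')) (fun z => f z)))) s)) → ∀ (V : NNReal → ProbabilityTheory.Kernel (Literature.MathematicalPhysics.KineticTheory.HeatConduction.PhaseSpace N) (Literature.MathematicalPhysics.KineticTheory.HeatConduction.PhaseSpace N)), (∀ (t : NNReal) (x : Literature.MathematicalPhysics.KineticTheory.HeatConduction.PhaseSpace N), V t x = MeasureTheory.Measure.sum fun n => U n ((t : ℝ), x)) → ∀ (μ : MeasureTheory.Measure (Literature.MathematicalPhysics.KineticTheory.HeatConduction.PhaseSpace N)) [MeasureTheory.SFinite μ], (∀ (t : ℝ) (f : Literature.MathematicalPhysics.KineticTheory.HeatConduction.PhaseSpace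 N → ENNReal), Measurable f → MeasureTheory.lintegral μ (fun x => MeasureTheory.lintegral (K (t, x)) (fun z => f z)) = MeasureTheory.lintegral μ (fun z => f z)) → (∀ f : Literature.MathematicalPhysics.KineticTheory.HeatConduction.PhaseSpace N → ENNReal, Measurable f → MeasureTheory.lintegral μ (fun x => MeasureTheory.lintegral (Q x) (fun z => f z)) = MeasureTheory.lintegral μ (fun z => f z)) → ∀ t : NNReal, μ.bind (V t) = μ :=
  fun _ K Q _ _ hr U _ hU0 hUsucc V hV _ _ hK hQ t => bind_V_of_invariant K Q hr U hU0 hUsucc V hV hK hQ t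

end Summit.AtomisticToContinuum.FouriersLaw.Theorems.VanishingNoiseBound.JumpPerturbation

end
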